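/-
Copyright: the b2b-balaban T⁴-continuum CRUX team, row NE7b owner lineage `t4-ne7b-p1` (gen 116). Project licence.
-/
import Summits.QuantumFields.BalabanUV.T4Continuum.Spine.NE7b.SupBackgroundPeriodic

/-!
# THE BACKGROUND IS TRANSLATION-COVARIANT: for (60)'s background map `σ` (any `σ` with its closed-ball and uniqueness letters), a
# COARSE translation of the coarse field translates the background by the corresponding FINE vector —
# `σ(w(· + t))(q) = σ(w)(q + (n+1)·t)` on the chart ball — so every local letter of the sup column (locality, region, gradient) holds
# with the same constants at every site: the local problem is the same everywhere (row NE7b, node U5c; (73)'s translation lemmas BY NAME;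
# [folklore])

Cell `pub-balaban`, sub-cell `t4`, spine estimate NE7b (`T4WeightBudget.RelWeightBound`; the cell's OWN estimate — NOT PRINTED in
[Bałaban 1983–89], NOT PROVED).  Crux-route work under `Spine/NE7b/` by the row OWNER (`t4-ne7b-p1` gen 116) under FREEZE (0)'s
crux-prover clause (FILING-CLAIM C-ne7bp1-g116-10); NOTHING of Bałaban's is named, valued or asserted; no `T4Continuum/Support` leaf
typed; no `def`, no notation; zero `sorry`.  Imports (BY NAME): the owner's (73) `…SupBackgroundPeriodic` (`exists_clm_translate`,
`translate_norm_le`, `sum_AX_translate_apply`, `blockAvg_translate_apply`; through it (55) `blk_translate`, `sum_B_translate`, (60)).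

WHY (located).  (73) proved that the background of a PERIODIC coarse field is periodic — the translation argument for period multiples
(`w(· + s·t) = w`).  The same argument with a general coarse vector `t` gives COVARIANCE: the fine translate `τ_{(n+1)t}(σ w)` has block
means `τ_t w`, solves the sitewise system (the site matrix and the block structure commute with block translations, (55)
`AX_translate` ∕ `blk_translate`), has the same norm, so (60)'s uniqueness identifies it with `σ(τ_t w)`.  Consequence: the sup
column is HOMOGENEOUS — every site-indexed letter ((63) ∕ (64) ∕ (75) ∕ the owner's region letters) at `p` is the letter at `0` for
translated data; (73) is the special case `τ_t w = w`.

WHAT IS PROVED ([folklore]; `ℓ^∞ := lp (fun _ : X d => ℝ) ∞`):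
* §1 **`background_translate_of_letters`** — for `Q′, A` with the displayed actions and ANY `σ` with (60)'s closed-ball letter on a
  set `S` of coarse fields and the uniqueness letter at radius `r`: if `w ∈ S` and `w_t(y) = w(y + t)` is its coarse translate,
  then `σ w_t (q) = σ w (q + (n+1)·t)` for every `q` (no hypothesis on `w_t`: uniqueness alone pins it).
* §2 **`background_translate_closedBall`** — the instance `S = closedBall 0 R₀` (translation preserves the sup norm, so `w_t ∈ S`
  too): `σ (τ_t w)(q) = σ w (q + (n+1)·t)` and `τ_t w` stays in the ball, with `τ_t` the coarse translation operator of (73) §1.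
* §3 toy.

HONEST (what this is NOT).  Coarse translations only (fine translations that are not block vectors do not preserve the block
structure); no statement about the response ∕ covariance (they follow by differentiating, or from (73) §4's pattern — not typed);
scalar `ℤ^d`; nothing of the covariant `H_k`, (A3) ∕ (A1c) (NC-NE7b-α UNRULED).  BY-NAME EFFECT ON THE WALL: NONE.  NE7b NOT PRINTED ∕
NOT PROVED; spine PROVED 0∕9; rung (B)+1 on a FINITE torus — NOT infinite volume, NOT the mass gap, NOT Clay.  HONEST DEPENDENCY:
continuum YM on T⁴ ⇐ BetaPertH ∧ nine spine estimates (0∕9 proved); BetaPertH ⇐ (D1) ∧ (D4) ∧ CAP+tail; G-an2-4 gates asym, D1 and NE2∕3∕4.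
-/

set_option autoImplicit false

noncomputable section

namespace Summit.QuantumFields.BalabanUV.T4Continuum.NE7b.SupBackgroundTranslation

open scoped ENNReal NNReal
open Metric Set
open Literature.MathematicalPhysics.QuantumFieldTheory.Balaban1983to89
open B6QGQLower276 (X e blk B mem_B sum_B_const AX side)
open B5Hk103ScalarZd (nbhd)
open LocalNemytskiiSup (abs_apply_le_norm)
open OneShotChartTorusRowsZd (sum_B_translate blk_translate)
open SupBackgroundPeriodic (exists_clm_translate translate_norm_le sum_AX_translate_apply blockAvg_translate_apply)

variable {d : ℕ}

/-! ## §1. Covariance from the two letters -/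

/-- **THE BACKGROUND IS TRANSLATION-COVARIANT**, for `Q′, A` with the displayed actions and ANY `σ` with (60)'s closed-ball letter on a
set `S` (`‖σ w‖ ≤ r`, `Q′(σ w) = w`, the sitewise equation) and uniqueness letter at radius `r`: if `w ∈ S` and `w_t(y) = w(y + t)`,
then `σ w_t (q) = σ w (q + (n+1)·t)` — the fine translate of `σ w` is a competitor with block means `w_t`, and uniqueness pins `σ w_t`.
[folklore] -/
theorem background_translate_of_letters (n : ℕ) {a : ℝ} (Dop Aop : lp (fun _ : X d => ℝ) ∞ →L[ℝ] lp (fun _ : X d => ℝ) ∞)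
    (hD : ∀ (f : lp (fun _ : X d => ℝ) ∞) (y : X d), Dop f y = (((n : ℝ) + 1) ^ d)⁻¹ * ∑ p ∈ B n y, f p)
    (hA : ∀ (f : lp (fun _ : X d => ℝ) ∞) (p : X d), Aop f p = ∑ r ∈ nbhd n p, AX n a p r * f r)
    {u : ℝ → ℝ} {r : ℝ} {σ : lp (fun _ : X d => ℝ) ∞ → lp (fun _ : X d => ℝ) ∞} {S : Set (lp (fun _ : X d => ℝ) ∞)}
    (hσ : ∀ w ∈ S, σ w ∈ closedBall 0 r ∧ Dop (σ w) = w ∧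
      ∀ p : X d, Aop (σ w) p + u (σ w p) = (((n : ℝ) + 1) ^ d)⁻¹ * ∑ p' ∈ B n (blk n p), (Aop (σ w) p' + u (σ w p')))
    (huniq : ∀ φ ∈ closedBall (0 : lp (fun _ : X d => ℝ) ∞) r,
      (∀ p : X d, Aop φ p + u (φ p) = (((n : ℝ) + 1) ^ d)⁻¹ * ∑ p' ∈ B n (blk n p), (Aop φ p' + u (φ p'))) → σ (Dop φ) = φ)
    (t : X d) {w wt : lp (fun _ : X d => ℝ) ∞} (hw : w ∈ S) (hshift : ∀ y : X d, wt y = w (y + t)) (q : X d) :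
    σ wt q = σ w (q + side n • t) := by
  obtain ⟨hball, hDw, heq⟩ := hσ w hw
  obtain ⟨τ, hτ, -⟩ := exists_clm_translate (side n • t)
  -- the fine translate is a competitor: same radius, block means `wt`, same sitewise equation
  have hφball : τ (σ w) ∈ closedBall (0 : lp (fun _ : X d => ℝ) ∞) r := by
    rw [mem_closedBall, dist_zero_right] at hball ⊢
    exact (translate_norm_le _ τ hτ (σ w)).trans hball
  have hAτ : ∀ p : X d, Aop (τ (σ w)) p = Aop (σ w) (p + side n • t) := fun p => by
    rw [hA, hA]; exact sum_AX_translate_apply n a t (fun q' => hτ (σ w) q') p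
  have hφeq : ∀ p : X d, Aop (τ (σ w)) p + u (τ (σ w) p)
      = (((n : ℝ) + 1) ^ d)⁻¹ * ∑ p' ∈ B n (blk n p), (Aop (τ (σ w)) p' + u (τ (σ w) p')) := by
    intro p
    rw [hAτ, hτ, heq (p + side n • t), blk_translate, sum_B_translate]
    exact congrArg _ (Finset.sum_congr rfl fun p' _ => by rw [hAτ, hτ])
  have hDφ : Dop (τ (σ w)) = wt := by
    refine lp.ext (funext fun y => ?_)
    rw [hD, blockAvg_translate_apply n t (fun q' => hτ (σ w) q') y, ← hD, hDw, hshift]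
  have h := huniq _ hφball hφeq
  rw [hDφ] at h
  have h' := congrArg (fun f : lp (fun _ : X d => ℝ) ∞ => f q) h
  simp only [hτ] at h'
  exact h'

/-! ## §2. The chart-ball instance -/

/-- **COVARIANCE ON THE CHART BALL**: with `S = closedBall 0 R₀` (translation-invariant) and the coarse translation operator `τ_t` of
(73) §1 (`τ_t w (y) = w(y + t)`, `‖τ_t w‖ ≤ ‖w‖`): for every `w` in the ball, `σ (τ_t w) (q) = σ w (q + (n+1)·t)` and `τ_t w` is in
the ball (so `σ (τ_t w)` carries the closed-ball letters too). [folklore] -/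
theorem background_translate_closedBall (n : ℕ) {a : ℝ} (Dop Aop : lp (fun _ : X d => ℝ) ∞ →L[ℝ] lp (fun _ : X d => ℝ) ∞)
    (hD : ∀ (f : lp (fun _ : X d => ℝ) ∞) (y : X d), Dop f y = (((n : ℝ) + 1) ^ d)⁻¹ * ∑ p ∈ B n y, f p)
    (hA : ∀ (f : lp (fun _ : X d => ℝ) ∞) (p : X d), Aop f p = ∑ r ∈ nbhd n p, AX n a p r * f r)
    {u : ℝ → ℝ} {r R₀ : ℝ} {σ : lp (fun _ : X d => ℝ) ∞ → lp (fun _ : X d => ℝ) ∞}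
    (hσ : ∀ w ∈ closedBall (0 : lp (fun _ : X d => ℝ) ∞) R₀, σ w ∈ closedBall 0 r ∧ Dop (σ w) = w ∧
      ∀ p : X d, Aop (σ w) p + u (σ w p) = (((n : ℝ) + 1) ^ d)⁻¹ * ∑ p' ∈ B n (blk n p), (Aop (σ w) p' + u (σ w p')))
    (huniq : ∀ φ ∈ closedBall (0 : lp (fun _ : X d => ℝ) ∞) r,
      (∀ p : X d, Aop φ p + u (φ p) = (((n : ℝ) + 1) ^ d)⁻¹ * ∑ p' ∈ B n (blk n p), (Aop φ p' + u (φ p'))) → σ (Dop φ) = φ)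
    (t : X d) (τc : lp (fun _ : X d => ℝ) ∞ →L[ℝ] lp (fun _ : X d => ℝ) ∞)
    (hτc : ∀ (f : lp (fun _ : X d => ℝ) ∞) (y : X d), τc f y = f (y + t))
    {w : lp (fun _ : X d => ℝ) ∞} (hw : w ∈ closedBall (0 : lp (fun _ : X d => ℝ) ∞) R₀) (q : X d) :
    σ (τc w) q = σ w (q + side n • t) ∧ τc w ∈ closedBall (0 : lp (fun _ : X d => ℝ) ∞) R₀ := by
  have hwt : τc w ∈ closedBall (0 : lp (fun _ : X d => ℝ) ∞) R₀ := by
    rw [mem_closedBall, dist_zero_right] at hw ⊢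
    exact (translate_norm_le t τc hτc w).trans hw
  exact ⟨background_translate_of_letters n Dop Aop hD hA hσ huniq t hw (fun y => hτc w y) q, hwt⟩

/-! ## §3. Toy -/

/-- Toy: the coarse translation operator exists with the displayed action and norm `≤ 1` ((73) §1 at a coarse vector). -/
example (t : X d) : ∃ τ : lp (fun _ : X d => ℝ) ∞ →L[ℝ] lp (fun _ : X d => ℝ) ∞,
    (∀ (f : lp (fun _ : X d => ℝ) ∞) (y : X d), τ f y = f (y + t)) ∧ ‖τ‖ ≤ 1 :=
  exists_clm_translate t

end Summit.QuantumFields.BalabanUV.T4Continuum.NE7b.SupBackgroundTranslation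

end
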